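import Mathlib
import Summits.ABC.ABC.Theses.TwistAmplification
import Literature.NumberTheory.EllipticCurves.RealPeriod
import HarnessLib

/-!
# Route TwistAmplification — crux `SomeWindowSaving` (stmt-ABC-1976), line `Sketch`:
  stub `stub_cofiniteOfPeriodBounds` (E, period bounds ⟹ cofinite weak generalized Szpiro)

Line `Sketch` (card A, period quantisation) reduces the crux — equivalently cofinite weak
generalized Szpiro, `M⁺ := max(|Δ|, |c₄|³) ≤ N^K` for every minimal integral model of conductor
`N ≥ N₀` — to two bounds on the real period `Ω(W₀) = (W₀ ⊗ ℝ).realPeriod` of an integral model: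

* (upper, hypothesis 1 = stub A0) `Ω(W₀) ≤ C₀ · (M⁺)^{-1/12} · log(2 + M⁺)` whenever `Δ(W₀) ≠ 0`;
* (lower, hypothesis 2 = `PeriodLowerBound`) `Ω(W₀) ≥ C · N^{-K}` (`C > 0`) for minimal models.

This file proves the elementary bookkeeping step combining the two:
`M⁺ ≤ N^{24·max(K,0)+1}` as soon as `N ≥ max(1, (max(C₀,1)·24·3^{1/24}/C)^{24})`.

Proof.  Put `M = M⁺ ≥ 1` (as `|Δ| ≥ 1`), `K₊ = max(K,0)`, `x = M^{1/24}`, `y = N^{K₊}`.  Since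
`N ≥ 1`, `C y⁻¹ = C N^{-K₊} ≤ C N^{-K} ≤ Ω`.  By `log u ≤ u^ε/ε` (`Real.log_le_rpow_div`) with
`ε = 1/24` and `2 + M ≤ 3M`, `log(2+M) ≤ 24·3^{1/24}·x =: A·x`, so
`Ω ≤ max(C₀,1)·M^{-1/12}·A·x = max(C₀,1)·A·x⁻¹` (`M^{-1/12}·M^{1/24} = M^{-1/24}`).  Hence
`C x ≤ max(C₀,1)·A·y`, i.e. `x ≤ (max(C₀,1)·A/C)·y`, and raising to the 24-th power
`M = x^{24} ≤ (max(C₀,1)·A/C)^{24} · N^{24 K₊} ≤ N · N^{24 K₊} = N^{24 K₊ + 1}`.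

Everything used is Mathlib real analysis plus `WeierstrassCurve.map_Δ` (to read `Δ(W₀) ≠ 0` off
the ellipticity of `W₀ ⊗ ℚ`); no named-fact hypothesis.  Lands `--supports stmt-ABC-1976`.
-/

-- `Summit.<Summit>.<Problem>` is the mandated summit-side namespace (CONVENTIONS §2); for the
-- single-conjunct summit `ABC` the two coincide, so the duplicate `ABC.ABC` is deliberate.
set_option linter.dupNamespace false

noncomputable section

open WeierstrassCurve IsDedekindDomain MeasureTheory

namespace Summit.ABC.ABC.Theorems

namespace CofiniteOfPeriodBounds

/-- `log(2 + M) ≤ 24 · 3^{1/24} · M^{1/24}` for `M ≥ 1`: `log u ≤ u^ε / ε` with `ε = 1/24`,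
`u = 2 + M ≤ 3M`, and `(3M)^{1/24} = 3^{1/24} M^{1/24}`. [folklore] -/
theorem log_two_add_le {M : ℝ} (hM : 1 ≤ M) :
    Real.log (2 + M) ≤ 24 * (3 : ℝ) ^ ((1 : ℝ) / 24) * M ^ ((1 : ℝ) / 24) := by
  have hM0 : 0 ≤ M := by linarith
  have h1 : Real.log (2 + M) ≤ (2 + M) ^ ((1 : ℝ) / 24) / ((1 : ℝ) / 24) :=
    Real.log_le_rpow_div (by linarith) (by norm_num)
  have h2 : (2 + M) ^ ((1 : ℝ) / 24) ≤ (3 * M) ^ ((1 : ℝ) / 24) :=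
    Real.rpow_le_rpow (by linarith) (by linarith) (by norm_num)
  have h3 : (3 * M) ^ ((1 : ℝ) / 24) = (3 : ℝ) ^ ((1 : ℝ) / 24) * M ^ ((1 : ℝ) / 24) :=
    Real.mul_rpow (by norm_num) hM0
  rw [h3] at h2
  calc Real.log (2 + M) ≤ (2 + M) ^ ((1 : ℝ) / 24) / ((1 : ℝ) / 24) := h1
    _ = 24 * (2 + M) ^ ((1 : ℝ) / 24) := by ring
    _ ≤ 24 * ((3 : ℝ) ^ ((1 : ℝ) / 24) * M ^ ((1 : ℝ) / 24)) := by gcongr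
    _ = _ := by ring

/-- **The real-analysis core.**  If `C N^{-K} ≤ Ω ≤ C₀ M^{-1/12} log(2+M)` with `C > 0`,
`M ≥ 1`, `N ≥ 1` and `N ≥ (max(C₀,1) · 24 · 3^{1/24} / C)^{24}`, then `M ≤ N^{24 max(K,0) + 1}`.
[folklore] -/
theorem le_rpow_of_period_bounds {C₀ K C M N Ω : ℝ} (hC : 0 < C) (hM : 1 ≤ M) (hN : 1 ≤ N)
    (hup : Ω ≤ C₀ * M ^ (-(1 : ℝ) / 12) * Real.log (2 + M))
    (hlow : C * N ^ (-K) ≤ Ω)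
    (hT : (max C₀ 1 * (24 * (3 : ℝ) ^ ((1 : ℝ) / 24)) / C) ^ (24 : ℕ) ≤ N) :
    M ≤ N ^ (24 * max K 0 + 1) := by
  have hM0 : 0 < M := by linarith
  have hN0 : 0 < N := by linarith
  set C₁ : ℝ := max C₀ 1 with hC₁def
  set A : ℝ := 24 * (3 : ℝ) ^ ((1 : ℝ) / 24) with hAdef
  set Kp : ℝ := max K 0 with hKpdef
  set x : ℝ := M ^ ((1 : ℝ) / 24) with hxdef
  set y : ℝ := N ^ Kp with hydef
  have hx0 : 0 < x := Real.rpow_pos_of_pos hM0 _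
  have hy0 : 0 < y := Real.rpow_pos_of_pos hN0 _
  have hx0' : x ≠ 0 := hx0.ne'
  have hy0' : y ≠ 0 := hy0.ne'
  have hA0 : 0 < A := by positivity
  have hC₁1 : 1 ≤ C₁ := le_max_right _ _
  -- Step 1: the lower bound with the non-negative exponent `Kp = max(K,0)`.
  have hlow' : C * y⁻¹ ≤ Ω := by
    have h1 : N ^ (-Kp) ≤ N ^ (-K) :=
      Real.rpow_le_rpow_of_exponent_le hN (neg_le_neg (le_max_left _ _))
    have h2 : N ^ (-Kp) = y⁻¹ := Real.rpow_neg hN0.le Kp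
    calc C * y⁻¹ = C * N ^ (-Kp) := by rw [h2]
      _ ≤ C * N ^ (-K) := by gcongr
      _ ≤ Ω := hlow
  -- Step 2: the upper bound `Ω ≤ C₁ · A · x⁻¹`.
  have hlog0 : 0 ≤ Real.log (2 + M) := Real.log_nonneg (by linarith)
  have hlog : Real.log (2 + M) ≤ A * x := by
    have h := log_two_add_le hM
    simpa only [hAdef, hxdef, mul_assoc] using h
  have hpow0 : 0 ≤ M ^ (-(1 : ℝ) / 12) := Real.rpow_nonneg hM0.le _
  have hup' : Ω ≤ C₁ * A * x⁻¹ := by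
    have h1 : C₀ * M ^ (-(1 : ℝ) / 12) * Real.log (2 + M) ≤
        C₁ * M ^ (-(1 : ℝ) / 12) * Real.log (2 + M) := by
      have hle : C₀ ≤ C₁ := le_max_left _ _
      have h0 : 0 ≤ M ^ (-(1 : ℝ) / 12) * Real.log (2 + M) := mul_nonneg hpow0 hlog0
      calc C₀ * M ^ (-(1 : ℝ) / 12) * Real.log (2 + M)
          = C₀ * (M ^ (-(1 : ℝ) / 12) * Real.log (2 + M)) := by ring
        _ ≤ C₁ * (M ^ (-(1 : ℝ) / 12) * Real.log (2 + M)) :=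
          mul_le_mul_of_nonneg_right hle h0
        _ = _ := by ring
    have h2 : C₁ * M ^ (-(1 : ℝ) / 12) * Real.log (2 + M) ≤ C₁ * M ^ (-(1 : ℝ) / 12) * (A * x) := by
      have : 0 ≤ C₁ * M ^ (-(1 : ℝ) / 12) := mul_nonneg (by linarith) hpow0
      exact mul_le_mul_of_nonneg_left hlog this
    have h3 : M ^ (-(1 : ℝ) / 12) * x = x⁻¹ := by
      rw [hxdef, ← Real.rpow_add hM0, ← Real.rpow_neg hM0.le]
      norm_num
    calc Ω ≤ C₁ * M ^ (-(1 : ℝ) / 12) * (A * x) := le_trans hup (le_trans h1 h2)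
      _ = C₁ * A * (M ^ (-(1 : ℝ) / 12) * x) := by ring
      _ = C₁ * A * x⁻¹ := by rw [h3]
  -- Step 3: combine the two bounds: `x ≤ (C₁ A / C) · y`.
  have hcomb : C * y⁻¹ ≤ C₁ * A * x⁻¹ := le_trans hlow' hup'
  have hxy' : C * x ≤ C₁ * A * y := by
    have h := mul_le_mul_of_nonneg_right hcomb (mul_pos hx0 hy0).le
    calc C * x = C * y⁻¹ * (x * y) := by field_simp
      _ ≤ C₁ * A * x⁻¹ * (x * y) := h
      _ = C₁ * A * y := by field_simp
  have hxy : x ≤ (C₁ * A / C) * y := by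
    rw [div_mul_eq_mul_div, le_div_iff₀ hC]
    linarith
  -- Step 4: raise to the 24-th power.
  have hMx : M = x ^ (24 : ℕ) := by
    rw [hxdef, ← Real.rpow_natCast, ← Real.rpow_mul hM0.le]
    norm_num
  have hy24 : y ^ (24 : ℕ) = N ^ (24 * Kp) := by
    have h24 : (24 : ℝ) * Kp = Kp * ((24 : ℕ) : ℝ) := by push_cast; ring
    rw [h24, Real.rpow_mul hN0.le, Real.rpow_natCast]
  calc M = x ^ (24 : ℕ) := hMx
    _ ≤ ((C₁ * A / C) * y) ^ (24 : ℕ) := pow_le_pow_left₀ hx0.le hxy 24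
    _ = (C₁ * A / C) ^ (24 : ℕ) * y ^ (24 : ℕ) := mul_pow _ _ _
    _ ≤ N * N ^ (24 * Kp) := by
        rw [hy24]
        exact mul_le_mul_of_nonneg_right hT (Real.rpow_nonneg hN0.le _)
    _ = N ^ (24 * Kp + 1) := by rw [Real.rpow_add_one hN0.ne', mul_comm]

end CofiniteOfPeriodBounds

/-- **Stub E of line `Sketch` (crux `SomeWindowSaving`, stmt-ABC-1976): the two period bounds give
cofinite weak generalized Szpiro.**  If (1) `Ω(W₀) ≤ C₀ (M⁺)^{-1/12} log(2 + M⁺)` for every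
integral model with `Δ ≠ 0` (`M⁺ = max(|Δ|, |c₄|³)`, `Ω = (W₀ ⊗ ℝ).realPeriod`) and
(2) `Ω(W₀) ≥ C N^{-K}` (`C > 0`) for every minimal integral model of conductor `N`, then there are
`K', N₀` with `M⁺ ≤ N^{K'}` for every minimal integral model with `N ≥ N₀` (here
`K' = 24 max(K,0) + 1`, `N₀ = max(1, (max(C₀,1)·24·3^{1/24}/C)^{24})`; the hypotheses `c₄ ≠ 0`,
`c₆ ≠ 0` of the registered signature are not used).  Elementary real analysis
(`CofiniteOfPeriodBounds.le_rpow_of_period_bounds`); `Δ(W₀) ≠ 0` because `W₀ ⊗ ℚ` is elliptic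
(`WeierstrassCurve.map_Δ`). [folklore] -/
theorem stub_cofiniteOfPeriodBounds :
    (∃ C₀ : ℝ, ∀ W₀ : WeierstrassCurve ℤ, W₀.Δ ≠ 0 →
      (W₀.baseChange ℝ).realPeriod ≤
        C₀ * ((max |W₀.Δ| (|W₀.c₄| ^ 3) : ℤ) : ℝ) ^ (-(1 : ℝ) / 12) *
          Real.log (2 + ((max |W₀.Δ| (|W₀.c₄| ^ 3) : ℤ) : ℝ))) →
    (∃ K C : ℝ, 0 < C ∧ ∀ W₀ : WeierstrassCurve ℤ, (W₀.baseChange ℚ).IsElliptic →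
      (∀ v : HeightOneSpectrum ℤ, (W₀.baseChange ℚ).IsMinimalAt v) →
        C * (((W₀.baseChange ℚ).conductorNorm ℤ : ℕ) : ℝ) ^ (-K) ≤ (W₀.baseChange ℝ).realPeriod) →
    ∃ K N₀ : ℝ, ∀ W₀ : WeierstrassCurve ℤ, (W₀.baseChange ℚ).IsElliptic →
      (∀ v : HeightOneSpectrum ℤ, (W₀.baseChange ℚ).IsMinimalAt v) → W₀.c₄ ≠ 0 → W₀.c₆ ≠ 0 →
        N₀ ≤ (((W₀.baseChange ℚ).conductorNorm ℤ : ℕ) : ℝ) →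
          ((max |W₀.Δ| (|W₀.c₄| ^ 3) : ℤ) : ℝ) ≤
            (((W₀.baseChange ℚ).conductorNorm ℤ : ℕ) : ℝ) ^ K := by
  rintro ⟨C₀, hup⟩ ⟨K, C, hC, hlow⟩
  refine ⟨24 * max K 0 + 1,
    max 1 ((max C₀ 1 * (24 * (3 : ℝ) ^ ((1 : ℝ) / 24)) / C) ^ (24 : ℕ)), ?_⟩
  intro W₀ hE hmin _hc₄ _hc₆ hN₀
  -- `Δ(W₀) ≠ 0`: `Δ(W₀ ⊗ ℚ) = Δ(W₀)` is a unit of `ℚ`.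
  have hΔ : W₀.Δ ≠ 0 := by
    intro h
    apply hE.isUnit.ne_zero
    simp [WeierstrassCurve.baseChange, WeierstrassCurve.map_Δ, h]
  have hM : (1 : ℝ) ≤ ((max |W₀.Δ| (|W₀.c₄| ^ 3) : ℤ) : ℝ) := by
    have h1 : (1 : ℤ) ≤ max |W₀.Δ| (|W₀.c₄| ^ 3) :=
      le_trans (Int.one_le_abs hΔ) (le_max_left _ _)
    exact_mod_cast h1
  have hN : (1 : ℝ) ≤ (((W₀.baseChange ℚ).conductorNorm ℤ : ℕ) : ℝ) :=
    le_trans (le_max_left _ _) hN₀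
  have hT := le_trans (le_max_right _ _) hN₀
  exact CofiniteOfPeriodBounds.le_rpow_of_period_bounds hC hM hN (hup W₀ hΔ) (hlow W₀ hE hmin) hT

end Summit.ABC.ABC.Theorems

end
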